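import Summits.BirchSwinnertonDyer.Rank1Residual.Additive.X3BranchResidualCountOfCharacterFacts
import HarnessLib

/-!
# X3: the character of the QUOTIENT `W[p]/Φ₀` from the character `φ` of the line — `ψ = ω·φ⁻¹` as an
# explicit PRIMITIVE Dirichlet character of level `p·m` acting on `W[p]` modulo `Φ₀` (`φψ = ω`,
# GV p. 28), for the DISPLAY form of the certificate road
# (cell `bsd-eis`, seat `bsd-eis-x3` gen 3; route K1 `AdditiveBranchIMC` — supports only)

HONEST FRAMING (cell `bsd-eis`, `run/shared/lean/pub/bsd-eis/README.md` §4): THEOREMS ONLY; nothing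
booked. The display form of the residual count (`X3BranchResidualCountOfCharacters.lean`) takes the
character `ψ` of `W[p]/Φ₀` explicitly, with the proof `hψ0 : σ • P − ψ(χ_d(σ))·P ∈ Φ₀` and
`ψ.IsPrimitive`. Given the line character `φ` (primitive mod `m`, `p ∤ m`; on the X3 rows at `p = 3`
the quadratic character of the kernel field, `X3BranchLineCharacterPrimeDisc.lean`), THIS FILE
produces `ψ` with both proofs: `ψ = ω_p·φ⁻¹` lifted to level `p·m`
(`changeLevel ω * changeLevel φ⁻¹`, `ω_p = MulChar.ofUnitHom (MonoidHom.id _)` the tautological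
character of `(ℤ/p)ˣ` in `𝔽_p`), which ACTS on the quotient because `φ·ψ' = χ_p` for the abstract
quotient character `ψ'` (the Weil-pairing lemma `X3Branch.natCast_mul_eq_modNCyclotomicCharacter_of_line`)
and is PRIMITIVE of conductor `p·m` (conductors of characters with coprime conductors multiply).

* `X3Branch.smul_sub_quotCharacter_mem` — `hψ0` for `ψ = changeLevel ω_p * changeLevel φ⁻¹`;
* `X3Branch.quotCharacter_isPrimitive` — primitivity (`p` odd, `φ` primitive mod `m`, `p ∤ m`).

References: [GreenbergVatsal2000] §2 p. 28 ("`φψ = ω`"); [Washington1997] Ch. 3 (conductors).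
-/

set_option autoImplicit false

noncomputable section

open scoped Classical

namespace Summit.BirchSwinnertonDyer.Rank1Residual.Additive

open NumberField IsDedekindDomain Field WeierstrassCurve DirichletCharacter
  Literature.NumberTheory.GaloisRepresentations Literature.NumberTheory.EllipticCurves
  Literature.NumberTheory.EllipticCurves.Rank1Residual
  Summit.BirchSwinnertonDyer.Rank1Residual.X2.ResidualDevissageModules
  Summit.BirchSwinnertonDyer.Rank1Residual.X2.ResidualDevissageLine
  Summit.BirchSwinnertonDyer.Rank1Residual.X2.PrimeOrderCharacters
  Summit.BirchSwinnertonDyer.Rank1Residual.X2.ResidualLineCharacters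

variable {W : WeierstrassCurve ℚ} [W.IsElliptic] {p : ℕ} [hp : Fact p.Prime]
  {Φ₀ : AddSubgroup (geomTorsion W (p : ℤ))} (hΦ : IsRationalLine W p Φ₀)

/-! ### §1 Conductor bookkeeping (after the cell bsd-cm's `RouteUPsiD11.lean` §1) -/

omit hp in
/-- Characters with coprime conductors: `f(χψ) = f(χ)·f(ψ)` (`≤`: Mathlib's
`conductor_mul_dvd_lcm_conductor`; `≥`: `χ = (χψ)ψ⁻¹`). [cite: Washington1997, Ch. 3 (conductor of a product of characters of coprime conductor)] -/
private theorem conductor_mul_eq_mul_of_coprime' {R : Type*} [CommRing R] [IsDomain R] {n : ℕ}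
    [NeZero n] (χ ψ : DirichletCharacter R n) (h : χ.conductor.Coprime ψ.conductor) :
    (χ * ψ).conductor = χ.conductor * ψ.conductor := by
  apply Nat.dvd_antisymm
  · have := conductor_mul_dvd_lcm_conductor χ ψ
    rwa [h.lcm_eq_mul] at this
  · have hχ : χ.conductor ∣ (χ * ψ).conductor := by
      have h1 : χ = (χ * ψ) * ψ⁻¹ := by rw [mul_assoc, mul_inv_cancel, mul_one]
      have h2 := conductor_mul_dvd_lcm_conductor (χ * ψ) ψ⁻¹
      rw [← h1, conductor_inv] at h2
      exact h.dvd_of_dvd_mul_right (h2.trans (Nat.lcm_dvd_mul _ _))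
    have hψ : ψ.conductor ∣ (χ * ψ).conductor := by
      have h1 : ψ = (χ * ψ) * χ⁻¹ := by rw [mul_comm χ ψ, mul_assoc, mul_inv_cancel, mul_one]
      have h2 := conductor_mul_dvd_lcm_conductor (χ * ψ) χ⁻¹
      rw [← h1, conductor_inv] at h2
      exact h.symm.dvd_of_dvd_mul_right (h2.trans (Nat.lcm_dvd_mul _ _))
    exact h.mul_dvd_of_dvd_of_dvd hχ hψ

/-- **The tautological character `ω_p : (ℤ/p)ˣ → 𝔽_pˣ` (the Teichmüller character read in `𝔽_p`) is
non-trivial for `p ≠ 2`** (`ω_p(−1) = −1 ≠ 1`). [cite: Washington1997, Ch. 3] -/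
theorem X3Branch.tautologicalCharacter_ne_one (hp2 : p ≠ 2) :
    (MulChar.ofUnitHom (MonoidHom.id (ZMod p)ˣ) : DirichletCharacter (ZMod p) p) ≠ 1 := by
  have hpr : p.Prime := hp.out
  intro h
  have h1 : (MulChar.ofUnitHom (MonoidHom.id (ZMod p)ˣ) : DirichletCharacter (ZMod p) p)
      ((-1 : (ZMod p)ˣ) : ZMod p) = (1 : DirichletCharacter (ZMod p) p) ((-1 : (ZMod p)ˣ) : ZMod p) := by
    rw [h]
  rw [MulChar.ofUnitHom_coe, MonoidHom.id_apply, MulChar.one_apply_coe, Units.val_neg,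
    Units.val_one] at h1
  have h2 : (2 : ZMod p) = 0 := by linear_combination -h1
  have h2' : ((2 : ℕ) : ZMod p) = 0 := by exact_mod_cast h2
  rw [ZMod.natCast_eq_zero_iff] at h2'
  exact hp2 ((Nat.prime_dvd_prime_iff_eq hpr Nat.prime_two).mp h2')

/-- **`ψ = ω_p·φ⁻¹` at level `p·m` is PRIMITIVE** when `p` is odd, `φ` is primitive modulo `m` and
`p ∤ m`: its conductor is `f(ω_p)·f(φ⁻¹) = p·m`. [cite: Washington1997, Ch. 3 (conductors)] -/
theorem X3Branch.quotCharacter_isPrimitive (hp2 : p ≠ 2) {m : ℕ} [NeZero m]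
    (φ : DirichletCharacter (ZMod p) m) (hφ : φ.IsPrimitive) (hpm : ¬ p ∣ m) :
    (changeLevel (dvd_mul_right p m) (MulChar.ofUnitHom (MonoidHom.id (ZMod p)ˣ)) *
      changeLevel (dvd_mul_left m p) φ⁻¹ : DirichletCharacter (ZMod p) (p * m)).IsPrimitive := by
  have hpr : p.Prime := hp.out
  haveI : NeZero (p * m) := ⟨mul_ne_zero hpr.ne_zero (NeZero.ne m)⟩
  have hω : DirichletCharacter.conductor
      (MulChar.ofUnitHom (MonoidHom.id (ZMod p)ˣ) : DirichletCharacter (ZMod p) p) = p := by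
    have hd := conductor_dvd_level (MulChar.ofUnitHom (MonoidHom.id (ZMod p)ˣ) : DirichletCharacter (ZMod p) p)
    rcases (Nat.dvd_prime hpr).mp hd with h | h
    · exact absurd (eq_one_iff_conductor_eq_one.mpr h) (X3Branch.tautologicalCharacter_ne_one hp2)
    · exact h
  have hφc : DirichletCharacter.conductor φ⁻¹ = m := by rw [conductor_inv]; exact hφ
  have hcop : (DirichletCharacter.conductor (changeLevel (dvd_mul_right p m)
        (MulChar.ofUnitHom (MonoidHom.id (ZMod p)ˣ) : DirichletCharacter (ZMod p) p))).Coprime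
      (DirichletCharacter.conductor (changeLevel (dvd_mul_left m p) φ⁻¹)) := by
    rw [conductor_changeLevel, conductor_changeLevel, hω, hφc]
    exact (Nat.Prime.coprime_iff_not_dvd hpr).mpr hpm
  rw [isPrimitive_def, conductor_mul_eq_mul_of_coprime' _ _ hcop, conductor_changeLevel,
    conductor_changeLevel, hω, hφc]

/-! ### §2 `ψ = ω_p·φ⁻¹` acts on `W[p]` modulo `Φ₀` -/

include hΦ in
/-- **`hψ0` for the explicit quotient character**: if the primitive `φ` (mod `m`) acts on the rational
line `Φ₀` (`hφ0`), then `ψ = ω_p·φ⁻¹` (level `p·m`) acts on `W[p]/Φ₀`: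
`σ • P − ψ(χ_{pm}(σ))·P ∈ Φ₀` for all `σ`, `P` — because the abstract quotient character `ψ'`
(Kronecker–Weber) satisfies `φ·ψ' = χ_p` (Weil pairing), i.e. `ψ'(σ) = χ_p(σ)·φ(σ)⁻¹ = ψ(χ_{pm}(σ))`.
GV p. 28: "`φψ = ω`". [cite: GreenbergVatsal2000, §2 p. 28] -/
theorem X3Branch.smul_sub_quotCharacter_mem {m : ℕ} [NeZero m] (φ : DirichletCharacter (ZMod p) m)
    (hφ0 : ∀ (σ : absoluteGaloisGroup ℚ), ∀ P ∈ Φ₀,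
      σ • P = (φ ((modNCyclotomicCharacter ℚ m σ : (ZMod m)ˣ) : ZMod m)).val • P)
    (σ : absoluteGaloisGroup ℚ) (P : geomTorsion W (p : ℤ)) :
    σ • P - ((changeLevel (dvd_mul_right p m) (MulChar.ofUnitHom (MonoidHom.id (ZMod p)ˣ)) *
      changeLevel (dvd_mul_left m p) φ⁻¹ : DirichletCharacter (ZMod p) (p * m))
        ((modNCyclotomicCharacter ℚ (p * m) σ : (ZMod (p * m))ˣ) : ZMod (p * m))).val • P ∈ Φ₀ := by
  have hpr : p.Prime := hp.out
  haveI : NeZero (p * m) := ⟨mul_ne_zero hpr.ne_zero (NeZero.ne m)⟩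
  -- the abstract quotient character and the Weil pairing
  obtain ⟨d, _, ψ', -, -, hψ0'⟩ := exists_character_quot hΦ
  have hdet := X3Branch.natCast_mul_eq_modNCyclotomicCharacter_of_line hΦ (hφ0 σ) (hψ0' σ)
  rw [ZMod.natCast_zmod_val, ZMod.natCast_zmod_val] at hdet
  -- the value of the explicit character at `χ_{pm}(σ)`
  set u : (ZMod (p * m))ˣ := modNCyclotomicCharacter ℚ (p * m) σ with hu
  have hcastp : (ZMod.cast (u : ZMod (p * m)) : ZMod p) =
      ((modNCyclotomicCharacter ℚ p σ : (ZMod p)ˣ) : ZMod p) := by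
    rw [ZMod.cast_eq_val, hu, X3Branch.natCast_val_modNCyclotomicCharacter_of_dvd (dvd_mul_right p m)]
  have hcastm : (ZMod.cast (u : ZMod (p * m)) : ZMod m) =
      ((modNCyclotomicCharacter ℚ m σ : (ZMod m)ˣ) : ZMod m) := by
    rw [ZMod.cast_eq_val, hu, X3Branch.natCast_val_modNCyclotomicCharacter_of_dvd (dvd_mul_left m p)]
  have hφu : IsUnit (φ ((modNCyclotomicCharacter ℚ m σ : (ZMod m)ˣ) : ZMod m)) :=
    IsUnit.map φ (modNCyclotomicCharacter ℚ m σ).isUnit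
  have hφ0' : φ ((modNCyclotomicCharacter ℚ m σ : (ZMod m)ˣ) : ZMod m) ≠ 0 := hφu.ne_zero
  have hval : (changeLevel (dvd_mul_right p m) (MulChar.ofUnitHom (MonoidHom.id (ZMod p)ˣ)) *
      changeLevel (dvd_mul_left m p) φ⁻¹ : DirichletCharacter (ZMod p) (p * m)) (u : ZMod (p * m)) =
      ψ' ((modNCyclotomicCharacter ℚ d σ : (ZMod d)ˣ) : ZMod d) := by
    rw [MulChar.mul_apply, changeLevel_eq_cast_of_dvd, changeLevel_eq_cast_of_dvd, hcastp, hcastm,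
      MulChar.ofUnitHom_coe, MonoidHom.id_apply, MulChar.inv_apply_eq_inv']
    -- `χ_p(σ) · φ(σ)⁻¹ = ψ'(σ)` from `φ(σ) ψ'(σ) = χ_p(σ)`
    rw [← hdet]
    field_simp
  rw [hval]
  exact hψ0' σ P

end Summit.BirchSwinnertonDyer.Rank1Residual.Additive

end
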